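import Summits.BirchSwinnertonDyer.BirchSwinnertonDyer.Theorems.ErratumRoadFiveNonSurjCornerMuCore
import HarnessLib

/-!
# Route `SignedLowerHalves`, crux `KobayashiMainConjectureSmallImage` (item stmt-BirchSwinnertonDyer-19002):
# the EULER-SYSTEM `μ`-TRANSFER at NON-SURJECTIVE image, part 1 — the `μ`-vanishing of the dual FINE
# Selmer group `X₀(E/ℚ_∞)` at ANY reduction type, from ONE genuine Euler-system class not divisible
# by `p` (cell `bsd-ssimc`, WIDTH-LEVER lane B = seat `bsd-ssimc-k3-c4x` g0; helper file,
# `--supports stmt-BirchSwinnertonDyer-19002 --as helper`; theorems only)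

HONEST FRAMING.  Kobayashi's signed main conjecture at a non-surjective (normaliser-of-non-split-
Cartan) image is OPEN and stays so; nothing here is booked; BSD is not proved by any of this.  The
registered skeleton of crux 4 (`Cruxes/…/Lines/birth.lean`) splits the crux into the Eisenstein half
(`stub_lowerSmallImage`, engine-less) and the SATURATION `stub_saturationSmallImage` («lower ⇒
equality»), which lane A (`bsd-ssimc-k3-c4`) reduced to the `μ`-statement «`μ(X^ε(E/ℚ_∞)) = 0`»
(`Theorems.kobayashiMainConjecture_of_mu_eq_zero_of_lowerDivisibility`, p447454) and then supplied
`μ = 0` PER PAIR from a congruence PARTNER (CM curve / unit curve / CM newform; B. D. Kim 2009).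
This lane takes the road lane A is NOT on: `μ(X^ε) = 0` from `E`'s OWN signed `p`-adic `L`-function
through Kato's Euler system, CLASS-WIDE, with NO partner — the supersingular twin of rung K6's
kernel-checked `μ`-transfer (`X10.mu_eq_zero_of_fine`, `CoreTheoremAOddPrime_holds`), whose core
was proved «uniformly in the odd prime» with the binders «good, ordinary» INERT (module docstring of
`Theorems/SmallImageMuTransferMuTransferX9CoreAssemblyOdd`: «`p ≠ 2`, good, ordinary — the last two
inert»; its proof reads `intro … hp2 _ _ hirr hns …`).

PARTITION (cell bsd-ssimc): X7 (A7) × item 4's ENTIRE domain (odd good supersingular `p`, `a_p = 0`,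
`ρ̄_{E,p}` not onto) — types-the-object-of; closes NONE.

## What this file proves (kernel; no definition, no named fact, no `sorry`)

* §1 (no declaration) — the K6 core WITHOUT its two inert binders is ALREADY a tree theorem:
  `CoreAssembly.coreOdd_anyReduction_holds` (cell `bsd-stepL`, seat `corner-p1` g6, file
  `Theorems/ErratumRoadFiveNonSurjCornerMuCore.lean`, p486975; used at a MULTIPLICATIVE prime by
  `Theorems/ErratumRoadFiveNonSurjCornerMuTransferMult.lean`): for a globally minimal `W/ℚ`, ANY odd
  prime `p` with `E[p]` irreducible and `ρ̄_{E,p}` not surjective, the cyclotomic `(κ, γ)` and Kato's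
  pinned `𝐇¹_Γ(T_pW)` (`I`), one GENUINE `Λ`-adic Euler-system class `s ∉ p𝐇¹` forces some iterate
  `(conj_γ − id)^[J]` to kill every `E[p]`-lift of `Sel₀(ℚ_∞, E[p^∞])`.  It is consumed BY NAME here —
  the supersingular prime of item 4 is its third client (after good ordinary X9 / X10b and `p ∥ N`).
* §2 `fineSelmerDual_lengthAt_augIdealP_eq_zero_of_eulerSystemClass` — the same on the PINNED dual
  fine Selmer group: under §1's hypotheses every `Y : W.FineSelmerDualData κ γ` has
  `length_{(p)} X₀(E/ℚ_∞) = 0` (and is finitely generated) — i.e. `μ(X₀(E/ℚ_∞)) = 0` — via the tree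
  theorems `finite_fineSelmerInfty_pTorsion_of_forall_iterate_eq_zero`,
  `FineSelmerDualData.finite_quotient_augIdealP_of_finite_pTorsion`,
  `KatoMuSkeleton.lengthAt_eq_zero_of_finite_quotient_p`.  «Theorem A on pinned objects» at ANY
  reduction type.
* §3 `lengthAt_le_of_exact_coleman_of_image_localized` — the pure-`Λ` bookkeeping that turns
  Kobayashi's (7.21) + Thm. 6.2/6.3 into the transfer `μ(X₀) = 0 ⟹ μ(X^ε) = 0`: for `Λ`-linear
  `c : H → Λ`, `j : Λ → X`, `k : X → Y` with `H →ᶜ Λ →ʲ X →ᵏ Y` exact at `Λ` and at `X`, a submodule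
  `Z ≤ H` and `L ∈ Λ` such that `s·L ∈ c(Z)` for some `s ∉ 𝔭` and `L ∉ 𝔭`:
  `length_𝔭 X ≤ length_𝔭 Y`.  (K6's `Kato2004.lengthAt_X_le_lengthAt_fine` with the Coleman
  isomorphism composed in, so that no abstract `P` occurs.)  Part 2 (Literature: the `η = 1` Coleman /
  Poitou–Tate / Kato-12.6 package on pinned objects) and part 3 (the class-wide signed `μ`-transfer
  and the `stub_saturationSmallImage`-shaped closer) consume §2 and §3.

What is NOT here: the core (tree theorem, imported); any signed object (parts 2–3); the Eisenstein
half; anything booked.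

References: K. Kato, Astérisque 295 (2004) Thm. 12.4, Thm. 12.6 (p. 222), §13.3, §13.8 (pp. 228–229)
[Kato2004Asterisque]; B. Mazur, K. Rubin, Mem. AMS 799 (2004) Prop. 1.3.2, §4.4, §5.3 [MazurRubin2004];
J. S. Milne, *Arithmetic Duality Theorems* (2006) I Thm. 2.8, 4.10 [MilneADT2006]; R. Greenberg, LNM
1716 (1999) §1 p. 60 [GreenbergLNM1716]; S. Kobayashi, Invent. Math. 152 (2003) Thm. 6.2, 6.3, 7.3 (7.21)
[Kobayashi2003]; cell memo HOME/pub/bsd-smallim/koly/MU-TRANSFER-PROOF.md §§0–5 (the K6 cell's paper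
proof, kernel-checked by the files imported here); tree `Theorems/ErratumRoadFiveNonSurjCornerMuCore.lean`
(bsd-stepL corner-p1 g6, the reduction-free core) and `…MuTransferMult.lean` (the `p ∥ N` client).
-/

set_option linter.dupNamespace false
set_option autoImplicit false

noncomputable section

open scoped Classical NumberField
open WeierstrassCurve Field IsDedekindDomain
open Literature.NumberTheory.GaloisRepresentations
open Literature.NumberTheory.GaloisCohomology
open Literature.NumberTheory.EllipticCurves
open Literature.NumberTheory.EllipticCurves.Kato2004
open Literature.NumberTheory.EllipticCurves.Kato2004.EulerSystemValues
open Summit.BirchSwinnertonDyer.BirchSwinnertonDyer.Rank1Residual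
open Summit.BirchSwinnertonDyer.BirchSwinnertonDyer.Rank1Residual.CoreAssembly
open Summit.BirchSwinnertonDyer.Rank1Residual

namespace Summit.BirchSwinnertonDyer.BirchSwinnertonDyer.Theorems.SmallImageSignedMuTransfer

/-! ### §1 The K6 core at ANY reduction type — ALREADY IN THE TREE

The reduction-free core is the tree theorem `CoreAssembly.coreOdd_anyReduction_holds` (cell `bsd-stepL`,
seat `bsd-stepL-corner-p1` g6, file `Theorems/ErratumRoadFiveNonSurjCornerMuCore.lean`, p486975: K6's
`coreOdd_of_selmerDual_of_stepsTwoFour` with its two inert binders deleted, fed with the five landed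
inputs).  It is imported and used BY NAME below; nothing is restated. -/

/-! ### §2 «Theorem A» on the PINNED dual fine Selmer group, at any reduction type -/

/-- **`μ(X₀(E/ℚ_∞)) = 0` from one genuine Euler-system class not divisible by `p`, at ANY
reduction type.**  Under the hypotheses of `CoreAssembly.coreOdd_anyReduction_holds` (odd `p`, `E[p]` irreducible,
`ρ̄_{E,p}` not onto, cyclotomic `(κ, γ)`, a genuine `Λ`-adic Euler-system class `s ∈ 𝐇¹_Γ(T_pW)` with
`s ∉ p𝐇¹`), every Pontryagin-dual datum `Y` of the fine Selmer group `Sel₀(ℚ_∞, E[p^∞])`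
(`WeierstrassCurve.FineSelmerDualData`) is finitely generated over `Λ` with
`length_{Λ_(p)} X₀(E/ℚ_∞)_(p) = 0` — i.e. `μ(X₀(E/ℚ_∞)) = 0`.  Chain: the core gives `J` killing the
`E[p]`-lifts of `Sel₀`; hence `Sel₀(ℚ_∞, E[p^∞])[p]` is finite
(`finite_fineSelmerInfty_pTorsion_of_forall_iterate_eq_zero`); hence `X₀/pX₀` is finite and `X₀` is
finitely generated (`FineSelmerDualData.finite_quotient_augIdealP_of_finite_pTorsion`,
`module_finite_of_finite_pTorsion`); hence `length_(p) X₀ = 0`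
(`KatoMuSkeleton.lengthAt_eq_zero_of_finite_quotient_p`).
[cite: GreenbergLNM1716, §1 p. 60 (after Conj. 1.3)] [cite: Kato2004Asterisque, §13.8 (pp. 228–229) and Thm. 12.6 (p. 222)] -/
theorem fineSelmerDual_lengthAt_augIdealP_eq_zero_of_eulerSystemClass
    (W : WeierstrassCurve ℚ) [W.IsElliptic] [W.IsGloballyMinimal] (p : ℕ) [Fact p.Prime]
    [ContinuousSMul ℤ_[p] (W.tateModule p)] [Module.Free ℤ_[p] (W.tateModule p)]
    [Module.Finite ℤ_[p] (W.tateModule p)]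
    (κ : ZpExtension ℚ p) (γ : absoluteGaloisGroup ℚ) (I : IwasawaH1Data W p κ γ)
    (hp2 : p ≠ 2) (hirr : W.HasIrreducibleModPGaloisRep p) (hns : ¬ W.HasSurjectiveModNGaloisRep (p : ℤ))
    (hκ : κ.IsCyclotomic) (hγ : κ.IsTopGenerator γ)
    (hs : ∃ s : I.H, IsEulerSystemClass W p κ γ I s ∧
      s ∉ IwasawaAlgebra.augIdealP p • (⊤ : Submodule (IwasawaAlgebra p) I.H))
    (Y : W.FineSelmerDualData κ γ) (𝔭 : PrimeSpectrum (IwasawaAlgebra p))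
    (h𝔭 : 𝔭.asIdeal = IwasawaAlgebra.augIdealP p) :
    Module.Finite (IwasawaAlgebra p) Y.X ∧ Module.lengthAt (IwasawaAlgebra p) Y.X 𝔭 = 0 := by
  obtain ⟨J, hJ⟩ := CoreAssembly.coreOdd_anyReduction_holds W p κ γ I hp2 hirr hns hκ hγ hs
  have hfin := W.finite_fineSelmerInfty_pTorsion_of_forall_iterate_eq_zero κ hγ hJ
  haveI : Module.Finite (IwasawaAlgebra p) Y.X := Y.module_finite_of_finite_pTorsion hγ hfin
  haveI : Finite (Y.X ⧸ (IwasawaAlgebra.augIdealP p • (⊤ : Submodule (IwasawaAlgebra p) Y.X))) :=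
    Y.finite_quotient_augIdealP_of_finite_pTorsion hfin
  exact ⟨inferInstance, KatoMuSkeleton.lengthAt_eq_zero_of_finite_quotient_p (M := Y.X) 𝔭 h𝔭⟩

/-! ### §3 The pure-`Λ` bookkeeping of Kobayashi's (7.21) with the Coleman isomorphism composed in -/

section Bookkeeping

open Module

variable {p : ℕ} [Fact p.Prime] {H X Y : Type*}
  [AddCommGroup H] [Module (IwasawaAlgebra p) H] [AddCommGroup X] [Module (IwasawaAlgebra p) X]
  [AddCommGroup Y] [Module (IwasawaAlgebra p) Y]

/-- **`length_𝔭 X ≤ length_𝔭 Y` along `H →ᶜ Λ →ʲ X →ᵏ Y` (exact at `Λ` and at `X`) when the image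
`c(Z)` of a submodule `Z ≤ H` contains `s·L` with `s, L ∉ 𝔭`.**  Pure module theory over
`Λ = ℤ_p⟦T⟧`: `M := c(Z)` is an ideal with `¬ M ≤ 𝔭` (else `s·L ∈ 𝔭`, `𝔭` prime), so
`length_𝔭 (Λ/M) = 0` (`lengthAt_quotient_eq_zero_of_not_le`); `M ≤ range c = ker j`, so `j` factors
through `Λ/M → X`, still exact before `k`; hence `length_𝔭 X ≤ length_𝔭 (Λ/M) + length_𝔭 Y =
length_𝔭 Y` (`lengthAt_le_add_of_exact`).  This is K6's `Kato2004.lengthAt_X_le_lengthAt_fine` in the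
shape of Kobayashi's (7.21) read through Thm. 6.2 (the Coleman map an isomorphism onto `Λ`, so the
local term of (7.21) IS `Λ` and `c = Col^ε ∘ loc_p`): with `X = X^ε(E/ℚ_∞)`, `Y = X₀(E/ℚ_∞)`,
`Z` the zeta submodule and `L = L_p^ε(E)` at `𝔭 = (p)` it reads «`μ(L_p^ε) = 0 ∧ μ(X₀) = 0 ⟹
μ(X^ε) = 0`».  Nothing about any curve is asserted here.
[cite: Kobayashi2003, Thm. 6.2 (6.13)/(6.14), Thm. 6.3 and Thm. 7.3 i) (7.21) (pp. 11–13)]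
[cite: Kato2004Asterisque, §17.13 (p. 280)] -/
theorem lengthAt_le_of_exact_coleman_of_image_localized
    (c : H →ₗ[IwasawaAlgebra p] IwasawaAlgebra p) (j : IwasawaAlgebra p →ₗ[IwasawaAlgebra p] X)
    (k : X →ₗ[IwasawaAlgebra p] Y) (hcj : Function.Exact c j) (hjk : Function.Exact j k)
    (Z : Submodule (IwasawaAlgebra p) H) {L s : IwasawaAlgebra p}
    (𝔭 : PrimeSpectrum (IwasawaAlgebra p)) (hs : s ∉ 𝔭.asIdeal) (hL : L ∉ 𝔭.asIdeal)
    (hsL : s * L ∈ Submodule.map c Z) :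
    lengthAt (IwasawaAlgebra p) X 𝔭 ≤ lengthAt (IwasawaAlgebra p) Y 𝔭 := by
  set M : Ideal (IwasawaAlgebra p) := Submodule.map c Z with hM
  have hnot : ¬ M ≤ 𝔭.asIdeal := fun hle ↦ by
    rcases 𝔭.isPrime.mem_or_mem (hle hsL) with h | h
    · exact hs h
    · exact hL h
  have hΛM : lengthAt (IwasawaAlgebra p) (IwasawaAlgebra p ⧸ M) 𝔭 = 0 :=
    lengthAt_quotient_eq_zero_of_not_le hnot
  have hle : M ≤ LinearMap.ker j := by
    rintro _ ⟨z, -, rfl⟩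
    exact (hcj (c z)).mpr ⟨z, rfl⟩
  let j' : (IwasawaAlgebra p ⧸ M) →ₗ[IwasawaAlgebra p] X := M.liftQ j hle
  have hj' : Function.Exact j' k := by
    rw [LinearMap.exact_iff, Submodule.range_liftQ]
    exact LinearMap.exact_iff.mp hjk
  calc lengthAt (IwasawaAlgebra p) X 𝔭
      ≤ lengthAt (IwasawaAlgebra p) (IwasawaAlgebra p ⧸ M) 𝔭 + lengthAt (IwasawaAlgebra p) Y 𝔭 :=
        lengthAt_le_add_of_exact j' k hj' 𝔭
    _ = lengthAt (IwasawaAlgebra p) Y 𝔭 := by rw [hΛM, zero_add]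

/-- **Indivisibility of a class from its Coleman image.**  If `c : H → Λ` is `Λ`-linear and
`c z ∉ pΛ` (e.g. `c z` generates the same localized ideal as an `L ∉ (p)`), then `z ∉ p·H`.  With
`c = Col^ε ∘ loc_p` and `c(z_Kato) = L_p^ε(E)` (Kobayashi Thm. 6.3) this is «`μ(L_p^ε) = 0 ⟹ z_Kato ∉
p𝐇¹`», the first step of the `μ`-transfer (K6's `Kato2004.exists_mem_zeta_not_mem_of_mu_eq_zero`).
[cite: Kobayashi2003, Thm. 6.3 (p. 11)] [cite: Kato2004Asterisque, §17.13 (p. 280)] -/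
theorem not_mem_pSmul_of_apply_not_mem (c : H →ₗ[IwasawaAlgebra p] IwasawaAlgebra p) {z : H}
    (hz : c z ∉ IwasawaAlgebra.augIdealP p) :
    z ∉ IwasawaAlgebra.augIdealP p • (⊤ : Submodule (IwasawaAlgebra p) H) := by
  intro hmem
  apply hz
  have hsub : Submodule.map c (IwasawaAlgebra.augIdealP p • (⊤ : Submodule (IwasawaAlgebra p) H)) ≤
      (IwasawaAlgebra.augIdealP p • ⊤ : Submodule (IwasawaAlgebra p) (IwasawaAlgebra p)) := by
    rw [Submodule.map_smul'']
    exact Submodule.smul_mono le_rfl le_top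
  have htop : (IwasawaAlgebra.augIdealP p • ⊤ : Submodule (IwasawaAlgebra p) (IwasawaAlgebra p)) =
      IwasawaAlgebra.augIdealP p := by
    rw [Ideal.smul_eq_mul, Ideal.mul_top]
  rw [← htop]
  exact hsub ⟨z, hmem, rfl⟩

/-- **Some genuine Euler-system class is indivisible by `p`** when the zeta submodule `Z` lies in the
span of genuine classes (Kato Thm. 12.6 + Ex. 13.3), `c(Z)` and `(L)` agree at `(p)` up to some
`s ∉ (p)`, and `L ∉ (p)` (`μ(L) = 0`): at `𝔭 = (p)`, `s·L ∈ c(Z)` with `s, L ∉ (p)` forbids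
`Z ⊆ p·H` (else `c(Z) ⊆ (p)`), and a submodule not inside `p·H` spanned by a set has a member of the
set outside `p·H` (`Kato2004.exists_mem_not_mem_of_le_span`).  The signed twin of K6's
`Kato2004.exists_isEulerSystemClass_not_mem`; the set `S` is abstract here.
[cite: Kato2004Asterisque, Thm. 12.6 (p. 222) and §17.13 (p. 280)] [cite: Kobayashi2003, Thm. 6.3 (p. 11)] -/
theorem exists_mem_set_not_mem_pSmul (c : H →ₗ[IwasawaAlgebra p] IwasawaAlgebra p)
    (Z : Submodule (IwasawaAlgebra p) H) {S : Set H} (hZ : Z ≤ Submodule.span (IwasawaAlgebra p) S)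
    {L s : IwasawaAlgebra p} (hs : s ∉ IwasawaAlgebra.augIdealP p)
    (hL : L ∉ IwasawaAlgebra.augIdealP p) (hsL : s * L ∈ Submodule.map c Z) :
    ∃ z ∈ S, z ∉ IwasawaAlgebra.augIdealP p • (⊤ : Submodule (IwasawaAlgebra p) H) := by
  -- some `z ∈ Z` is outside `p·H`
  have hex : ∃ z ∈ Z, z ∉ IwasawaAlgebra.augIdealP p • (⊤ : Submodule (IwasawaAlgebra p) H) := by
    by_contra hcon
    push Not at hcon
    have hZle : Z ≤ IwasawaAlgebra.augIdealP p • (⊤ : Submodule (IwasawaAlgebra p) H) :=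
      fun z hz ↦ hcon z hz
    have hsub : Submodule.map c Z ≤
        (IwasawaAlgebra.augIdealP p • ⊤ : Submodule (IwasawaAlgebra p) (IwasawaAlgebra p)) :=
      (Submodule.map_mono hZle).trans (by rw [Submodule.map_smul'']; exact Submodule.smul_mono le_rfl le_top)
    have htop : (IwasawaAlgebra.augIdealP p • ⊤ : Submodule (IwasawaAlgebra p) (IwasawaAlgebra p)) =
        IwasawaAlgebra.augIdealP p := by
      rw [Ideal.smul_eq_mul, Ideal.mul_top]
    have hsL' : s * L ∈ IwasawaAlgebra.augIdealP p := by rw [← htop]; exact hsub hsL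
    rcases (IwasawaAlgebra.isPrime_augIdealP_holds p).mem_or_mem hsL' with h | h
    · exact hs h
    · exact hL h
  obtain ⟨z, hz, hzp⟩ := hex
  exact exists_mem_not_mem_of_le_span hZ hz hzp

end Bookkeeping

end Summit.BirchSwinnertonDyer.BirchSwinnertonDyer.Theorems.SmallImageSignedMuTransfer

end
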